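import Summits.AtomisticToContinuum.FouriersLaw.Theorems.BondHeatUncertaintyLightConeBondHeatTentReduction
import Summits.AtomisticToContinuum.FouriersLaw.Theorems.OddSectorIrreversibilitySubBallisticWindowGibbsPoincare
import Summits.AtomisticToContinuum.FouriersLaw.Theorems.OddSectorIrreversibilitySubBallisticWindowGibbsMoments

/-!
# `N`-uniform statics of the tent energy, and the reduction of `LightConeBondHeat` to one dynamical quantity

Support file for item `stmt-AtomisticToContinuum-9123` (`BondHeatUncertainty.LightConeBondHeat`, (S_lc)), third part of
the bulk-bond (tent) reduction.  The tent reduction (`…LightConeBondHeatTentReduction`) bounds the equilibrium bond-heat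
variance by a block term and a static term, `V_N(b₀,t) ≤ (4t/(L+1)²) ∫₀ᵗ |K_J| + 8 ∫ (W - m)² dμ_T`.  Here the static term is
SETTLED, uniformly in `N`:

* `pinnedChain_tentEnergy_variance_le` — `∃ c ∀ N b₀ L, ∫ (W - ∫ W dμ_T)² dμ_T ≤ c (L+1)` for the tent-weighted energy of
  `L` consecutive sites: the `N`-uniform Poincaré inequality for the Gibbs weight (PROVED in the tree from Brascamp–Lieb,
  `SubBallisticWindow.GibbsPoincare.stub_gibbsPoincare`), the `N`-uniform coordinate moments it implies
  (`SubBallisticWindow.GibbsMoments.stub_gibbsMoments`) and the Dirichlet-form bound for weighted energies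
  (`SubBallisticWindow.RampCorrector.gradient_bound`), transported from `e^{-H/T} dq dp` to `μ_T`;
* **`pinnedChain_bondHeatVar_le_blockGK`** — hence `∃ c ∀ N, b₀ + L + 1 < N, t ≥ 0`:
  `V_N(b₀,t) ≤ (4t/(L+1)²) ∫₀ᵗ |K_J(s)| ds + 8c(L+1)`, `K_J(s) = ∫ J · P_s J dμ_T`, `J = ∑_{b₀ ≤ k ≤ b₀+L} j_k`;
* **`lightConeBondHeat_of_openBlockDiffusion`** — the honest CONDITIONAL closure of the item: an `N`-uniform diffusive
  ceiling `V_N^J(t) ≤ C(1+t)(L+1)` for the block functional of the OPEN chain (the open-chain analogue of crux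
  `OddSectorIrreversibility.SubBallisticWindow`, stmt-AtomisticToContinuum-14070) implies `LightConeBondHeat` (bond `0`,
  `a = 1`, `N₀ = 3`, `A = 4C⁺ + 16c⁺`, tent length `⌊√t⌋`);

Upshot for the item: at a bulk bond, (S_lc) — indeed any `N`-uniform windowed law `V_N(b_N, τ_N) ≤ B τ_N^θ`, `θ < 1`,
which already drives the NonBallistic rung (`…LightConeBondHeatWindowedTransfer`) — is reduced to ONE dynamical statement
about the equilibrium open chain: an `N`-uniform sublinear bound on the absolute block Green–Kubo integral,
`∫₀ᵗ |K_J(s)| ds ≤ (L+1) k(t)` with `k(t) = O(t^{1-δ})`, for blocks of length `L ≍ √(t k(t))` next to the bond (inside the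
light cone for `t ≤ aN`).  `k ≡ const` gives Edwards–Wilkinson `V = O(√t)`; the static size `k(t) ≤ t·sup_s|K_J(s)|/(L+1) = O(t)`
returns `θ = 1`, the ballistic value at which the transfer inequality is void.  Nothing here closes an item.
-/

noncomputable section

open MeasureTheory Filter Topology Set intervalIntegral
open scoped NNReal ENNReal

namespace Summit.AtomisticToContinuum.FouriersLaw.Theorems.LightConeBondHeat

open Literature.MathematicalPhysics.KineticTheory.HeatConduction
open Literature.MathematicalPhysics.KineticTheory Literature.Probability.Process OscillatorChain
open Summit.AtomisticToContinuum.FouriersLaw.Theorems.SubBallisticWindow.Negative.ClosedFlow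
open Summit.AtomisticToContinuum.FouriersLaw.Theorems.SubdiffusiveBondHeat
open Summit.AtomisticToContinuum.FouriersLaw.Theses.BondHeatUncertainty

/-! ### `N`-uniform statics of the tent energy: Poincaré (Brascamp–Lieb) + `N`-uniform Gibbs moments -/

/-- **The tent energy has `O(L)` variance in the Gibbs state, uniformly in `N` and in the position of the block.**  For the
pinned anharmonic chain (`ω₂ > 0`, `lam, β ≥ 0`, any `γ`) and `T > 0` there is `c` such that for EVERY `N`, bond `b₀` and
block length `L`, the tent-weighted energy `W` (`weightedEnergy`, weights `w_k = (b₀+L+1-k)/(L+1)` on `b₀ < k ≤ b₀+L`,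
`|w_k| ≤ 1`, supported on `L` sites) satisfies `∫ (W - ∫ W dμ_T)² dμ_T ≤ c (L + 1)` (`μ_T = gibbsMeasure N T`).  Proof:
the `N`-uniform Poincaré inequality for the Gibbs weight `e^{-H/T} dq dp` (`SubBallisticWindow.GibbsPoincare.stub_gibbsPoincare`,
Brascamp–Lieb for the `min(ω₂,1)`-convex `H`), the `N`-uniform coordinate moments it implies
(`SubBallisticWindow.GibbsMoments.stub_gibbsMoments`), the Dirichlet-form bound `∫ |∇W_w|² ≤ C·D·L²(b-a)·Z` for bounded,
finitely supported weights (`SubBallisticWindow.RampCorrector.gradient_bound`), and the normalisation `μ_T = Z⁻¹ e^{-H/T} dq dp`.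
[folklore] -/
theorem pinnedChain_tentEnergy_variance_le {ω₂ lam β : ℝ} (hω : 0 < ω₂) (hl : 0 ≤ lam) (hβ : 0 ≤ β) (γ : ℝ) {T : ℝ}
    (hT : 0 < T) :
    ∃ c : ℝ, ∀ (N b₀ L : ℕ),
      ∫ z, (weightedEnergy (pinnedChain ω₂ lam β γ)
            (fun k : ℕ => if b₀ < k ∧ k ≤ b₀ + L then ((b₀ : ℝ) + L + 1 - k) / (L + 1) else 0) N z -
          ∫ y, weightedEnergy (pinnedChain ω₂ lam β γ)
            (fun k : ℕ => if b₀ < k ∧ k ≤ b₀ + L then ((b₀ : ℝ) + L + 1 - k) / (L + 1) else 0) N y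
            ∂((pinnedChain ω₂ lam β γ).gibbsMeasure N T)) ^ 2 ∂((pinnedChain ω₂ lam β γ).gibbsMeasure N T) ≤
        c * ((L : ℝ) + 1) := by
  -- the `N`-uniform Poincaré inequality and the `N`-uniform moments it implies
  have hP := Summit.AtomisticToContinuum.FouriersLaw.Theorems.SubBallisticWindow.GibbsPoincare.stub_gibbsPoincare
    ω₂ lam β γ hω hl hβ T hT
  obtain ⟨C₁, hC₁⟩ := Summit.AtomisticToContinuum.FouriersLaw.Theorems.SubBallisticWindow.GibbsMoments.stub_gibbsMoments
    ω₂ lam β γ hω hl hβ T hT hP 1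
  obtain ⟨C₃, hC₃⟩ := Summit.AtomisticToContinuum.FouriersLaw.Theorems.SubBallisticWindow.GibbsMoments.stub_gibbsMoments
    ω₂ lam β γ hω hl hβ T hT hP 3
  set D : ℝ := max (max C₁ C₃) 0 with hD
  have hD0 : 0 ≤ D := le_max_right _ _
  have hC₁D : C₁ ≤ D := (le_max_left _ _).trans (le_max_left _ _)
  have hC₃D : C₃ ≤ D := (le_max_right _ _).trans (le_max_left _ _)
  set K : ℝ := ((6 * ω₂ ^ 2 + 6 * lam ^ 2 + 1) + 4 * (12 + 192 * β ^ 2)) * (3 * D) with hK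
  refine ⟨T / min ω₂ 1 * K, fun N b₀ L => ?_⟩
  set P := pinnedChain ω₂ lam β γ with hPdef
  set wt : ℕ → ℝ := fun k : ℕ => if b₀ < k ∧ k ≤ b₀ + L then ((b₀ : ℝ) + L + 1 - k) / (L + 1) else 0 with hwt
  set G := weightedEnergy P wt N with hG
  set μw : Measure (PhaseSpace N) := volume.withDensity fun x : PhaseSpace N =>
    ENNReal.ofReal (Real.exp (-(P.hamiltonian N x) / T)) with hμw
  set Z : ℝ := ∫ x : PhaseSpace N, Real.exp (-(P.hamiltonian N x) / T) with hZ
  -- the partition function is positive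
  have hρ : Integrable (fun x : PhaseSpace N => Real.exp (-(P.hamiltonian N x) / T)) :=
    pinnedChain_integrable_gibbsDensity hω hl hβ γ N hT
  have hZpos : 0 < Z := integral_exp_pos hρ
  -- the weights: bounded by `1`, supported in `(b₀, b₀ + L + 1)`
  have hw1 : ∀ k, |wt k| ≤ 1 := by
    intro k
    simp only [hwt]
    split_ifs with h
    · have hL : (0 : ℝ) < (L : ℝ) + 1 := by positivity
      rw [abs_le]
      constructor
      · rw [le_div_iff₀ hL]
        have : (k : ℝ) ≤ (b₀ : ℝ) + L := by exact_mod_cast h.2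
        linarith
      · rw [div_le_iff₀ hL]
        have : (b₀ : ℝ) + 1 ≤ (k : ℝ) := by exact_mod_cast h.1
        linarith
    · simp
  have hws : ∀ k, wt k ≠ 0 → b₀ < k ∧ k < b₀ + L + 1 := by
    intro k hk
    simp only [hwt] at hk
    by_cases h : b₀ < k ∧ k ≤ b₀ + L
    · exact ⟨h.1, by omega⟩
    · rw [if_neg h] at hk
      exact absurd rfl hk
  -- `N`-uniform moments of the coordinates
  have hmo : ∀ i : Fin N, ∫ x, x.1 i ^ 2 ∂μw ≤ D * Z ∧ ∫ x, x.1 i ^ 6 ∂μw ≤ D * Z ∧ ∫ x, x.2 i ^ 2 ∂μw ≤ D * Z := by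
    intro i
    obtain ⟨h1q, h1p⟩ := hC₁ N i
    obtain ⟨h3q, -⟩ := hC₃ N i
    simp only [Nat.mul_one] at h1q h1p
    refine ⟨h1q.trans ?_, ?_, h1p.trans ?_⟩
    · exact mul_le_mul_of_nonneg_right hC₁D hZpos.le
    · have : ∫ x, x.1 i ^ 6 ∂μw = ∫ x, x.1 i ^ (2 * 3) ∂μw := by norm_num
      rw [this]
      exact h3q.trans (mul_le_mul_of_nonneg_right hC₃D hZpos.le)
    · exact mul_le_mul_of_nonneg_right hC₁D hZpos.le
  -- the Dirichlet form of the tent energy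
  obtain ⟨hGI, hgrad⟩ := Summit.AtomisticToContinuum.FouriersLaw.Theorems.SubBallisticWindow.RampCorrector.gradient_bound
    hω hl hβ γ hT (by omega : b₀ ≤ b₀ + L + 1) hw1 hws hD0 hZpos.le hmo
  -- the Poincaré inequality for `G = W`
  have hGc1 : ContDiff ℝ 1 G := contDiff_weightedEnergy P (pinnedChain_contDiff_U ω₂ lam β γ (n := 1))
    (pinnedChain_contDiff_V ω₂ lam β γ (n := 1)) wt N
  have hGL2 : MemLp G 2 μw :=
    Summit.AtomisticToContinuum.FouriersLaw.Theorems.OddSectorWitness.memLp_two_of_abs_le_pow hω hl hβ γ N hT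
      hGc1.continuous.aestronglyMeasurable 1 1 fun x => by
        have h := Summit.AtomisticToContinuum.FouriersLaw.Theorems.SubBallisticWindow.RampCorrector.abs_weightedEnergy_le
          hω.le hl hβ γ hw1 x
        have hH0 := pinnedChain_hamiltonian_nonneg hω.le hl hβ γ N x
        rw [pow_one]
        linarith
  have key := hP N G hGc1 hGL2 hGI
  have hbound : ∫ x, (G x - (∫ y, G y ∂μw) / Z) ^ 2 ∂μw ≤ T / min ω₂ 1 * K * ((L : ℝ) + 1) * Z := by
    have hcast : ((b₀ + L + 1 : ℕ) : ℝ) - (b₀ : ℝ) = (L : ℝ) + 1 := by push_cast; ring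
    rw [hcast] at hgrad
    have hTm : 0 ≤ T / min ω₂ 1 := div_nonneg hT.le (le_min hω.le zero_le_one)
    calc ∫ x, (G x - (∫ y, G y ∂μw) / Z) ^ 2 ∂μw
        ≤ T / min ω₂ 1 * ∫ x, (∑ i : Fin N, ((partialQ i G x) ^ 2 + (partialP i G x) ^ 2)) ∂μw := key
      _ ≤ T / min ω₂ 1 * (K * (1 ^ 2 * ((L : ℝ) + 1)) * Z) := mul_le_mul_of_nonneg_left hgrad hTm
      _ = T / min ω₂ 1 * K * ((L : ℝ) + 1) * Z := by ring
  -- normalisation: `∫ g dμ_T = Z⁻¹ ∫ g dμw`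
  have hnorm : ∀ g : PhaseSpace N → ℝ, ∫ x, g x ∂(P.gibbsMeasure N T) = Z⁻¹ * ∫ x, g x ∂μw := by
    intro g
    rw [P.integral_gibbsMeasure,
      Summit.AtomisticToContinuum.FouriersLaw.Theorems.SubBallisticWindow.GibbsPoincare.integral_gibbsWeight_eq]
    rfl
  have hmean : ∫ y, G y ∂(P.gibbsMeasure N T) = (∫ y, G y ∂μw) / Z := by
    rw [hnorm, div_eq_inv_mul]
  rw [hmean, hnorm]
  rw [inv_mul_le_iff₀ hZpos]
  calc ∫ x, (G x - (∫ y, G y ∂μw) / Z) ^ 2 ∂μw ≤ T / min ω₂ 1 * K * ((L : ℝ) + 1) * Z := hbound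
    _ = Z * (T / min ω₂ 1 * K * ((L : ℝ) + 1)) := by ring

/-- **The bulk-bond reduction of the bond-heat variance to ONE dynamical quantity.**  For the pinned anharmonic chain (all
four parameters `> 0`) and `T > 0` there is `c` (statics only) such that for every `N`, every bond `b₀` and block
length `L` with `b₀ + L + 1 < N`, and every `t ≥ 0`:

  `V_N(b₀, t) ≤ (4t/(L+1)²) ∫₀ᵗ |K_J(s)| ds + 8 c (L + 1)`,

`K_J(s) = ∫ J · P_s J dμ_T` the equilibrium autocorrelation of the block current `J = ∑_{b₀ ≤ k ≤ b₀+L} j_k` (constructed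
kernels at equal bath temperatures, Gibbs measure; `V_N(b₀,t)` verbatim the functional of the route items (S)/(S_lc) at
the bond `⟨b₀, _⟩`).  Consequently ANY `N`-uniform sublinear bound on the absolute block Green–Kubo integral,
`∫₀ᵗ |K_J(s)| ds ≤ (L+1)·k(t)` with `k(t) = O(t^{1-δ})` for blocks inside the light cone, yields by `L + 1 ≍ √(t k(t)/c)` an
`N`-uniform windowed law `V_N(b₀,t) = O(t^{1-δ/2})` and hence, through `…LightConeBondHeatWindowedTransfer`
(`nonBallistic_of_windowed_bondHeat`, `θ = 1 - δ/2 < 1`), the NonBallistic rung of the route; `k` bounded gives the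
Edwards–Wilkinson form `V = O(√t)` of (S_lc) itself.  The dynamical input is the only unproved ingredient. [folklore] -/
theorem pinnedChain_bondHeatVar_le_blockGK {ω₂ lam β γ : ℝ} (hω : 0 < ω₂) (hl : 0 ≤ lam) (hβ : 0 < β) (hγ : 0 < γ)
    {T : ℝ} (hT : 0 < T) :
    ∃ c : ℝ, ∀ (N b₀ L : ℕ) (hbL : b₀ + L + 1 < N) (t : ℝ), 0 ≤ t →
      2 * ∫ s in (0 : ℝ)..t, (t - s) * ∫ z, (pinnedChain ω₂ lam β γ).bondCurrent N ⟨b₀, by omega⟩ z *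
          (∫ y, (pinnedChain ω₂ lam β γ).bondCurrent N ⟨b₀, by omega⟩ y
            ∂((pinnedChain ω₂ lam β γ).transitionKernel N T T s.toNNReal z))
          ∂((pinnedChain ω₂ lam β γ).gibbsMeasure N T) ≤
        4 * t / ((L : ℝ) + 1) ^ 2 * (∫ s in (0 : ℝ)..t,
            |∫ z, (∑ k : Fin N, (if b₀ ≤ k.val ∧ k.val ≤ b₀ + L then (pinnedChain ω₂ lam β γ).bondCurrent N k z else 0)) *
              (∫ y, (∑ k : Fin N, (if b₀ ≤ k.val ∧ k.val ≤ b₀ + L then (pinnedChain ω₂ lam β γ).bondCurrent N k y else 0))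
                ∂((pinnedChain ω₂ lam β γ).transitionKernel N T T s.toNNReal z))
              ∂((pinnedChain ω₂ lam β γ).gibbsMeasure N T)|) +
          8 * (c * ((L : ℝ) + 1)) := by
  obtain ⟨c, hc⟩ := pinnedChain_tentEnergy_variance_le hω hl hβ.le γ hT
  refine ⟨c, fun N b₀ L hbL t ht => ?_⟩
  have h1 := pinnedChain_bondHeatVar_le_tent_abs hω hl hβ hγ hT hbL ht
    (∫ y, weightedEnergy (pinnedChain ω₂ lam β γ)
      (fun k : ℕ => if b₀ < k ∧ k ≤ b₀ + L then ((b₀ : ℝ) + L + 1 - k) / (L + 1) else 0) N y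
      ∂((pinnedChain ω₂ lam β γ).gibbsMeasure N T))
  have h2 := hc N b₀ L
  linarith [h1, h2]


/-! ### (S_lc) from diffusive block transport of the OPEN chain -/

/-- **`LightConeBondHeat` from an `N`-uniform diffusive bound on the block-current functional of the open chain.**
Suppose that for the pinned anharmonic chain (all parameters `> 0`) and every `T > 0` there is `C` such that for every
`N`, every block `[b₀, b₀+L]` of bonds with `b₀ + L + 1 < N` and every `t ≥ 0` the equilibrium block functional obeys the
diffusive (Einstein–Helfand) ceiling `V_N^J(t) = 2∫₀ᵗ (t-s) ∫ J · P_s J dμ_T ds ≤ C (1 + t)(L + 1)` — the OPEN-chain analogue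
of crux `OddSectorIrreversibility.SubBallisticWindow` (stmt-AtomisticToContinuum-14070, stated there for the closed
Hamiltonian flow).  Then `LightConeBondHeat` holds, with the bath bond `b = 0`, slope `a = 1`, `N₀ = 3` and
`A = 4 max(C,0) + 16 max(c,0)` (`c` the static constant of `pinnedChain_tentEnergy_variance_le`): for `1 ≤ t ≤ N` take the
tent of length `L = ⌊√t⌋` to the right of bond `0` in `pinnedChain_bondHeatVar_le_tent`.  (Recorded as the honest
conditional form of the bulk-bond line; the hypothesis is not an item of the route.) [folklore] -/
theorem lightConeBondHeat_of_openBlockDiffusion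
    (hD : ∀ ω₂ lam β γ : ℝ, 0 < ω₂ → 0 < lam → 0 < β → 0 < γ → ∀ T : ℝ, 0 < T → ∃ C : ℝ,
      ∀ (N b₀ L : ℕ), b₀ + L + 1 < N → ∀ t : ℝ, 0 ≤ t →
        2 * ∫ s in (0 : ℝ)..t, (t - s) *
          ∫ z, (∑ k : Fin N, (if b₀ ≤ k.val ∧ k.val ≤ b₀ + L then (pinnedChain ω₂ lam β γ).bondCurrent N k z else 0)) *
            (∫ y, (∑ k : Fin N, (if b₀ ≤ k.val ∧ k.val ≤ b₀ + L then (pinnedChain ω₂ lam β γ).bondCurrent N k y else 0))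
              ∂((pinnedChain ω₂ lam β γ).transitionKernel N T T s.toNNReal z))
            ∂((pinnedChain ω₂ lam β γ).gibbsMeasure N T) ≤ C * (1 + t) * ((L : ℝ) + 1)) :
    LightConeBondHeat := by
  intro ω₂ lam β γ hω hl hβ hγ T hT
  simp only []
  obtain ⟨C, hC⟩ := hD ω₂ lam β γ hω hl hβ hγ T hT
  obtain ⟨c, hc⟩ := pinnedChain_tentEnergy_variance_le hω hl.le hβ.le γ hT
  set C' : ℝ := max C 0 with hC'
  set c' : ℝ := max c 0 with hc'
  have hC'0 : 0 ≤ C' := le_max_right _ _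
  have hc'0 : 0 ≤ c' := le_max_right _ _
  refine ⟨4 * C' + 16 * c', 1, one_pos, 3, fun N hN => ⟨0, by omega, fun t ht1 htN => ?_⟩⟩
  rw [one_mul] at htN
  have ht0 : 0 ≤ t := by linarith
  -- the block length `L = ⌊√t⌋`
  set L : ℕ := ⌊Real.sqrt t⌋₊ with hL
  have hst1 : 1 ≤ Real.sqrt t := by rw [Real.le_sqrt' one_pos]; simpa using ht1
  have hst0 : 0 ≤ Real.sqrt t := Real.sqrt_nonneg _
  have hLle : (L : ℝ) ≤ Real.sqrt t := Nat.floor_le hst0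
  have hLlt : Real.sqrt t < (L : ℝ) + 1 := Nat.lt_floor_add_one _
  have hN3 : (3 : ℝ) ≤ (N : ℝ) := by exact_mod_cast hN
  have hsN : Real.sqrt t < (N : ℝ) - 1 := by
    have h1 : Real.sqrt t ≤ Real.sqrt N := Real.sqrt_le_sqrt htN
    have h2 : Real.sqrt (N : ℝ) < (N : ℝ) - 1 := by
      rw [Real.sqrt_lt' (by linarith)]
      nlinarith
    exact h1.trans_lt h2
  have hbL : 0 + L + 1 < N := by
    have h1 : (L : ℝ) + 1 < (N : ℝ) := by linarith
    have h2 : L + 1 < N := by exact_mod_cast h1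
    omega
  have hN0 : 0 < N := by omega
  simp only [dif_pos hN0]
  -- the tent reduction at bond `0` with block length `L`, centred at the mean
  have key := pinnedChain_bondHeatVar_le_tent hω hl.le hβ hγ hT hbL ht0
    (∫ y, weightedEnergy (pinnedChain ω₂ lam β γ)
      (fun k : ℕ => if 0 < k ∧ k ≤ 0 + L then ((0 : ℕ) + (L : ℝ) + 1 - k) / (L + 1) else 0) N y
      ∂((pinnedChain ω₂ lam β γ).gibbsMeasure N T))
  have hJ := hC N 0 L hbL t ht0
  have hW := hc N 0 L
  have hL1 : (0 : ℝ) < (L : ℝ) + 1 := by positivity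
  -- the block term: `(2/(L+1)²)·C(1+t)(L+1) ≤ 4 C' √t`
  have hblock : 2 / ((L : ℝ) + 1) ^ 2 * (C * (1 + t) * ((L : ℝ) + 1)) ≤ 4 * C' * Real.sqrt t := by
    have h1 : C * (1 + t) * ((L : ℝ) + 1) ≤ C' * (1 + t) * ((L : ℝ) + 1) := by
      apply mul_le_mul_of_nonneg_right _ hL1.le
      exact mul_le_mul_of_nonneg_right (le_max_left _ _) (by linarith)
    have h2 : 2 / ((L : ℝ) + 1) ^ 2 * (C' * (1 + t) * ((L : ℝ) + 1)) = 2 * C' * (1 + t) / ((L : ℝ) + 1) := by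
      field_simp
    have h3 : 2 * C' * (1 + t) / ((L : ℝ) + 1) ≤ 2 * C' * (1 + t) / Real.sqrt t :=
      div_le_div_of_nonneg_left (by positivity) (by positivity) hLlt.le
    have h4 : 2 * C' * (1 + t) / Real.sqrt t ≤ 4 * C' * Real.sqrt t := by
      rw [div_le_iff₀ (by positivity)]
      have hsq : Real.sqrt t * Real.sqrt t = t := Real.mul_self_sqrt ht0
      nlinarith [hsq, hC'0]
    calc 2 / ((L : ℝ) + 1) ^ 2 * (C * (1 + t) * ((L : ℝ) + 1))
        ≤ 2 / ((L : ℝ) + 1) ^ 2 * (C' * (1 + t) * ((L : ℝ) + 1)) :=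
          mul_le_mul_of_nonneg_left h1 (by positivity)
      _ = 2 * C' * (1 + t) / ((L : ℝ) + 1) := h2
      _ ≤ 2 * C' * (1 + t) / Real.sqrt t := h3
      _ ≤ 4 * C' * Real.sqrt t := h4
  -- the static term: `8 c (L+1) ≤ 16 c' √t`
  have hstat : 8 * (c * ((L : ℝ) + 1)) ≤ 16 * c' * Real.sqrt t := by
    have h1 : c * ((L : ℝ) + 1) ≤ c' * ((L : ℝ) + 1) := mul_le_mul_of_nonneg_right (le_max_left _ _) hL1.le
    have h2 : (L : ℝ) + 1 ≤ 2 * Real.sqrt t := by linarith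
    nlinarith [mul_le_mul_of_nonneg_left h2 hc'0]
  have hV := key.trans (add_le_add (mul_le_mul_of_nonneg_left hJ (by positivity)) (mul_le_mul_of_nonneg_left hW (by norm_num)))
  calc _ ≤ _ := hV
    _ ≤ 4 * C' * Real.sqrt t + 16 * c' * Real.sqrt t := add_le_add hblock hstat
    _ = (4 * C' + 16 * c') * Real.sqrt t := by ring


end Summit.AtomisticToContinuum.FouriersLaw.Theorems.LightConeBondHeat

end
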